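import Literature.Analysis.Distribution.SymmetricPowerSpan
import Literature.Analysis.Distribution.NormalSymbolDescentFirstOrder
import Mathlib.Analysis.Normed.Module.Multilinear.Curry
import Mathlib.Algebra.Module.Projective
import Mathlib.LinearAlgebra.Basis.VectorSpace
import HarnessLib

/-!
# The contraction operator of a second-order symbol on normal jets

Topic `Analysis/Distribution`; namespace `Literature.Analysis.Distribution`. The linear algebra of the
second-order step of the uniqueness argument for distributions carried by `{0} × Z ⊂ B × Z`
(Hörmander, Thm. 2.3.5 with §3.1): a second-order operator `P = Σ_κ a_κ V_κ V'_κ` acts on the top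
normal jets of lifted jets through the **contraction** `C w = Σ_κ a_κ w(n'_κ, n_κ, ·)` of order-`(j+2)`
jets to order-`j` jets (`n_κ`, `n'_κ` the normal components of the fields on the subspace).

* §1 `evalFirstL`, `contractOp`, the quadratic form `qForm ℓ = Σ a_κ ℓ(n_κ) ℓ(n'_κ)`,
  `contractOp (powForm (j+2) ℓ) = qForm ℓ • powForm j ℓ`, the symmetrised operator
  `symContractOp = Sym ∘ C ∘ Sym` and its complex-linear structure;
* §2 **surjectivity onto symmetric jets** when `qForm η ≠ 0` for some real `η`: every power form is a
  limit of power forms in the range (`qForm (ℓ + s η) ≠ 0` for small `s ≠ 0`), the range is closed, and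
  symmetric forms lie in the span of powers (`SymmetricPowerSpan`); a linear right inverse;
* §3 smooth dependence on parameters and **smooth compactly supported preimages** near a point where
  the symbol is non-zero on some real covector.

Everything is proved; no named fact is introduced.

## References

* L. Hörmander, *The Analysis of Linear Partial Differential Operators I* (1983), Thm. 2.3.5, §3.1
  [HormanderALPDO1].
-/

noncomputable section

open Set Filter Topology Function Metric
open scoped ContDiff

namespace Literature.Analysis.Distribution

variable {B Z : Type*} [NormedAddCommGroup B] [NormedSpace ℝ B] [NormedAddCommGroup Z] [NormedSpace ℝ Z]

/-! ### 1. The contraction operator -/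

section Contract

/-- **Evaluation of the first slot**, linear in the vector and in the form:
`evalFirstL j x w = w(x, ·)`. [folklore] -/
def evalFirstL (j : ℕ) : B →L[ℝ] NormalJetSpace B (j + 1) →L[ℝ] NormalJetSpace B j :=
  ((continuousMultilinearCurryLeftEquiv ℝ (fun _ : Fin (j + 1) => B) ℂ).toContinuousLinearEquiv :
      NormalJetSpace B (j + 1) →L[ℝ] B →L[ℝ] NormalJetSpace B j).flip

/-- `evalFirstL j x w v = w (x, v)`. [folklore] -/
@[simp] theorem evalFirstL_apply (j : ℕ) (x : B) (w : NormalJetSpace B (j + 1)) (v : Fin j → B) :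
    evalFirstL (B := B) j x w v = w (Fin.cons x v) := rfl

variable {K : Type*} [Fintype K]

/-- **The contraction operator** `contractOp a n n' w = Σ_k a_k w(n'_k, n_k, ·)` from order-`(j+2)` to
order-`j` jets. [cite: HormanderALPDO1, Thm. 2.3.5, §3.1] -/
def contractOp (j : ℕ) (a : K → ℂ) (n n' : K → B) : NormalJetSpace B (j + 2) →L[ℝ] NormalJetSpace B j :=
  ∑ k, a k • (evalFirstL (B := B) j (n k)).comp (evalFirstL (B := B) (j + 1) (n' k))

/-- `contractOp j a n n' w v = Σ_k a_k w(n'_k, n_k, v)`. [folklore] -/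
@[simp] theorem contractOp_apply (j : ℕ) (a : K → ℂ) (n n' : K → B) (w : NormalJetSpace B (j + 2)) (v : Fin j → B) :
    contractOp j a n n' w v = ∑ k, a k * w (Fin.cons (n' k) (Fin.cons (n k) v)) := by
  simp [contractOp, sum_apply]

/-- `contractOp` is complex-homogeneous. [folklore] -/
theorem contractOp_smul (j : ℕ) (a : K → ℂ) (n n' : K → B) (c : ℂ) (w : NormalJetSpace B (j + 2)) :
    contractOp j a n n' (c • w) = c • contractOp j a n n' w := by
  ext v; simp [Finset.mul_sum, mul_left_comm]

/-- **The quadratic form of the symbol on real covectors**: `qForm a n n' ℓ = Σ_k a_k ℓ(n_k) ℓ(n'_k)`. [folklore] -/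
def qForm (a : K → ℂ) (n n' : K → B) (ℓ : B →L[ℝ] ℝ) : ℂ := ∑ k, a k * ((ℓ (n k) : ℝ) : ℂ) * ((ℓ (n' k) : ℝ) : ℂ)

/-- **Contraction of a power**: `C (ℓ^{⊗(j+2)}) = q(ℓ) ℓ^{⊗ j}`. [folklore] -/
theorem contractOp_powForm (j : ℕ) (a : K → ℂ) (n n' : K → B) (ℓ : B →L[ℝ] ℝ) :
    contractOp j a n n' (powForm (j + 2) ℓ) = qForm a n n' ℓ • powForm j ℓ := by
  ext v
  rw [contractOp_apply, smul_apply, powForm_apply, qForm, smul_eq_mul, Finset.sum_mul]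
  refine Finset.sum_congr rfl fun k _ => ?_
  rw [powForm_apply, Fin.prod_univ_succ, Fin.prod_univ_succ]
  simp only [Fin.cons_zero, Fin.cons_succ]
  ring

/-- `symmetrize` is symmetric. [folklore] -/
theorem symmetrize_comp_perm {j : ℕ} (m : NormalJetSpace B j) (v : Fin j → B) (σ : Equiv.Perm (Fin j)) :
    symmetrize m (v ∘ σ) = symmetrize m v := by
  rw [symmetrize_apply, symmetrize_apply]
  congr 1
  exact Fintype.sum_equiv (Equiv.mulLeft σ) _ _ fun τ => by simp [Equiv.Perm.coe_mul, Function.comp_assoc]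

/-- `symmetrize` is idempotent. [folklore] -/
theorem symmetrize_symmetrize {j : ℕ} (m : NormalJetSpace B j) : symmetrize (symmetrize m) = symmetrize m :=
  symmetrize_eq_self_of_forall_comp_perm (symmetrize_comp_perm m)

/-- `symmetrize` of a power form. [folklore] -/
theorem symmetrize_powForm (j : ℕ) (ℓ : B →L[ℝ] ℝ) : symmetrize (powForm j ℓ) = powForm j ℓ :=
  symmetrize_eq_self_of_forall_comp_perm (powForm_comp_perm j ℓ)

/-- `symmetrize` as a (real) continuous linear map. [folklore] -/
def symmetrizeCLM [FiniteDimensional ℝ B] (j : ℕ) : NormalJetSpace B j →L[ℝ] NormalJetSpace B j :=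
  LinearMap.toContinuousLinearMap
    { toFun := symmetrize
      map_add' := symmetrize_add
      map_smul' := fun c m => by
        ext v; simp [symmetrize_apply, Finset.mul_sum, mul_left_comm] }

/-- `symmetrizeCLM j m = symmetrize m`. [folklore] -/
@[simp] theorem symmetrizeCLM_apply [FiniteDimensional ℝ B] (j : ℕ) (m : NormalJetSpace B j) : symmetrizeCLM j m = symmetrize m := rfl

variable [FiniteDimensional ℝ B]

/-- **The symmetrised contraction** `T = Sym ∘ C ∘ Sym`. [folklore] -/
def symContractOp (j : ℕ) (a : K → ℂ) (n n' : K → B) : NormalJetSpace B (j + 2) →L[ℝ] NormalJetSpace B j :=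
  (symmetrizeCLM j).comp ((contractOp j a n n').comp (symmetrizeCLM (j + 2)))

/-- `symContractOp j a n n' w = Sym (C (Sym w))`. [folklore] -/
theorem symContractOp_apply (j : ℕ) (a : K → ℂ) (n n' : K → B) (w : NormalJetSpace B (j + 2)) :
    symContractOp j a n n' w = symmetrize (contractOp j a n n' (symmetrize w)) := rfl

/-- The symmetrised contraction takes symmetric values. [folklore] -/
theorem symmetrize_symContractOp (j : ℕ) (a : K → ℂ) (n n' : K → B) (w : NormalJetSpace B (j + 2)) :
    symmetrize (symContractOp j a n n' w) = symContractOp j a n n' w := by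
  rw [symContractOp_apply, symmetrize_symmetrize]

/-- The symmetrised contraction of a power. [folklore] -/
theorem symContractOp_powForm (j : ℕ) (a : K → ℂ) (n n' : K → B) (ℓ : B →L[ℝ] ℝ) :
    symContractOp j a n n' (powForm (j + 2) ℓ) = qForm a n n' ℓ • powForm j ℓ := by
  rw [symContractOp_apply, symmetrize_powForm, contractOp_powForm, symmetrize_smul, symmetrize_powForm]

/-- The symmetrised contraction is complex-homogeneous. [folklore] -/
theorem symContractOp_smul (j : ℕ) (a : K → ℂ) (n n' : K → B) (c : ℂ) (w : NormalJetSpace B (j + 2)) :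
    symContractOp j a n n' (c • w) = c • symContractOp j a n n' w := by
  rw [symContractOp_apply, symContractOp_apply, symmetrize_smul, contractOp_smul, symmetrize_smul]

/-- The symmetrised contraction as a complex-linear map. [folklore] -/
def symContractOpC (j : ℕ) (a : K → ℂ) (n n' : K → B) : NormalJetSpace B (j + 2) →ₗ[ℂ] NormalJetSpace B j where
  toFun := symContractOp j a n n'
  map_add' := map_add _
  map_smul' := symContractOp_smul j a n n'

/-- `symContractOpC j a n n' w = symContractOp j a n n' w`. [folklore] -/
@[simp] theorem symContractOpC_apply (j : ℕ) (a : K → ℂ) (n n' : K → B) (w : NormalJetSpace B (j + 2)) :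
    symContractOpC j a n n' w = symContractOp j a n n' w := rfl

end Contract

/-! ### 2. Surjectivity onto symmetric jets -/

section Surj

variable [FiniteDimensional ℝ B] {K : Type*} [Fintype K]

/-- A complex quadratic polynomial in a real variable with non-zero leading coefficient has no zeros
in a punctured neighbourhood of `0`. [folklore] -/
theorem eventually_quadratic_ne_zero (A A' c : ℂ) (hc : c ≠ 0) :
    ∃ δ : ℝ, 0 < δ ∧ ∀ s : ℝ, s ≠ 0 → |s| < δ → A + A' * s + c * s ^ 2 ≠ 0 := by
  by_cases hA : A = 0
  · subst hA
    by_cases hA' : A' = 0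
    · subst hA'
      refine ⟨1, one_pos, fun s hs _ => ?_⟩
      have : (s : ℂ) ≠ 0 := by exact_mod_cast hs
      simp [hc, this]
    · refine ⟨‖A'‖ / ‖c‖, div_pos (norm_pos_iff.2 hA') (norm_pos_iff.2 hc), fun s hs hsδ h0 => ?_⟩
      have h1 : A' + c * s = 0 := by
        have : (s : ℂ) * (A' + c * s) = 0 := by rw [← h0]; ring
        rcases mul_eq_zero.1 this with h | h
        · exact absurd (by exact_mod_cast h) hs
        · exact h
      have h2 : ‖c * s‖ < ‖A'‖ := by
        rw [norm_mul, Complex.norm_real, Real.norm_eq_abs]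
        calc ‖c‖ * |s| < ‖c‖ * (‖A'‖ / ‖c‖) := mul_lt_mul_of_pos_left hsδ (norm_pos_iff.2 hc)
          _ = ‖A'‖ := mul_div_cancel₀ _ (norm_ne_zero_iff.2 hc)
      have h3 : A' = -(c * s) := eq_neg_of_add_eq_zero_left h1
      rw [h3, norm_neg] at h2
      exact lt_irrefl _ h2
  · -- `A ≠ 0`: continuity at `0`
    have hcont : Continuous fun s : ℝ => A + A' * s + c * s ^ 2 := by continuity
    have hopen : IsOpen {s : ℝ | A + A' * s + c * s ^ 2 ≠ 0} := isOpen_ne_fun hcont continuous_const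
    have h0 : (0 : ℝ) ∈ {s : ℝ | A + A' * s + c * s ^ 2 ≠ 0} := by simpa using hA
    obtain ⟨δ, hδ, hball⟩ := Metric.isOpen_iff.1 hopen 0 h0
    refine ⟨δ, hδ, fun s _ hsδ => hball ?_⟩
    simpa [Real.dist_eq] using hsδ

omit [FiniteDimensional ℝ B] in
/-- The quadratic form along a line: `q(ℓ + s η) = q(ℓ) + s (…) + s² q(η)`. [folklore] -/
theorem qForm_add_smul (a : K → ℂ) (n n' : K → B) (ℓ η : B →L[ℝ] ℝ) (s : ℝ) :
    qForm a n n' (ℓ + s • η) = qForm a n n' ℓ +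
      (∑ k, a k * (((ℓ (n k) : ℝ) : ℂ) * ((η (n' k) : ℝ) : ℂ) + ((η (n k) : ℝ) : ℂ) * ((ℓ (n' k) : ℝ) : ℂ))) * s +
        qForm a n n' η * s ^ 2 := by
  simp only [qForm, add_apply, smul_apply, smul_eq_mul, Finset.sum_mul]
  rw [← Finset.sum_add_distrib, ← Finset.sum_add_distrib]
  refine Finset.sum_congr rfl fun k _ => ?_
  push_cast
  ring

omit [FiniteDimensional ℝ B] [Fintype K] in
/-- The power map `ℓ ↦ powForm j ℓ` is continuous. [folklore] -/
theorem continuous_powForm (j : ℕ) : Continuous fun ℓ : B →L[ℝ] ℝ => powForm (B := B) j ℓ := by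
  have : (fun ℓ : B →L[ℝ] ℝ => powForm (B := B) j ℓ) = fun ℓ => prodFormML j (fun _ => ℓ) := rfl
  rw [this]
  exact (prodFormML (B := B) j).cont.comp (continuous_pi fun _ => continuous_id)

/-- **Every power form lies in the range of the symmetrised contraction** when `qForm η ≠ 0` for some
real covector `η` (limit of `powForm (ℓ + s η)`, `s → 0`). [folklore] -/
theorem powForm_mem_range_symContractOpC (j : ℕ) {a : K → ℂ} {n n' : K → B} {η : B →L[ℝ] ℝ}
    (hη : qForm a n n' η ≠ 0) (ℓ : B →L[ℝ] ℝ) :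
    powForm j ℓ ∈ LinearMap.range (symContractOpC j a n n') := by
  set M := LinearMap.range (symContractOpC j a n n') with hMdef
  have hMclosed : IsClosed (M : Set (NormalJetSpace B j)) := M.closed_of_finiteDimensional
  obtain ⟨δ, hδ, hne⟩ := eventually_quadratic_ne_zero (qForm a n n' ℓ)
    (∑ k, a k * (((ℓ (n k) : ℝ) : ℂ) * ((η (n' k) : ℝ) : ℂ) + ((η (n k) : ℝ) : ℂ) * ((ℓ (n' k) : ℝ) : ℂ))) (qForm a n n' η) hη
  -- for small `s ≠ 0` the power of `ℓ + s η` is in the range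
  have hmem : ∀ s : ℝ, s ≠ 0 → |s| < δ → powForm j (ℓ + s • η) ∈ M := by
    intro s hs hsδ
    have hq : qForm a n n' (ℓ + s • η) ≠ 0 := by rw [qForm_add_smul]; exact hne s hs hsδ
    have h1 : powForm j (ℓ + s • η) = (qForm a n n' (ℓ + s • η))⁻¹ • symContractOpC j a n n' (powForm (j + 2) (ℓ + s • η)) := by
      rw [symContractOpC_apply, symContractOp_powForm, smul_smul, inv_mul_cancel₀ hq, one_smul]
    rw [h1]
    exact M.smul_mem _ (LinearMap.mem_range_self _ _)
  -- pass to the limit `s → 0`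
  have hcont : Continuous fun s : ℝ => powForm (B := B) j (ℓ + s • η) :=
    (continuous_powForm j).comp (continuous_const.add (continuous_id.smul continuous_const))
  have htend : Tendsto (fun s : ℝ => powForm (B := B) j (ℓ + s • η)) (𝓝[≠] 0) (𝓝 (powForm j ℓ)) := by
    have := (hcont.tendsto 0).mono_left (nhdsWithin_le_nhds (s := {(0 : ℝ)}ᶜ))
    simpa using this
  refine hMclosed.mem_of_tendsto htend (eventually_nhdsWithin_iff.2 (Metric.eventually_nhds_iff.2 ⟨δ, hδ, fun s hs hs0 => ?_⟩))
  exact hmem s hs0 (by simpa [Real.dist_eq] using hs)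

/-- **Symmetric jets lie in the range of the symmetrised contraction** when `qForm η ≠ 0` for some real
`η`. [cite: HormanderALPDO1, Thm. 2.3.5, §3.1] -/
theorem mem_range_symContractOpC_of_symmetric (j : ℕ) {a : K → ℂ} {n n' : K → B} {η : B →L[ℝ] ℝ}
    (hη : qForm a n n' η ≠ 0) {m : NormalJetSpace B j} (hm : ∀ (v : Fin j → B) (σ : Equiv.Perm (Fin j)), m (v ∘ σ) = m v) :
    m ∈ LinearMap.range (symContractOpC j a n n') :=
  mem_of_forall_powForm_mem _ (powForm_mem_range_symContractOpC j hη) hm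

/-- **A linear right inverse on symmetrisations**: `T (R m) = Sym m` for all `m`. [folklore] -/
theorem exists_rightInverse_symContractOp (j : ℕ) {a : K → ℂ} {n n' : K → B} {η : B →L[ℝ] ℝ} (hη : qForm a n n' η ≠ 0) :
    ∃ R : NormalJetSpace B j →L[ℝ] NormalJetSpace B (j + 2), ∀ m, symContractOp j a n n' (R m) = symmetrize m := by
  set T := symContractOpC j a n n'
  haveI : Module.Free ℂ ↥(LinearMap.range T) := Module.Free.of_divisionRing ℂ ↥(LinearMap.range T)
  haveI : Module.Projective ℂ ↥(LinearMap.range T) := Module.Projective.of_free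
  obtain ⟨g, hg⟩ := T.rangeRestrict.exists_rightInverse_of_surjective (LinearMap.range_rangeRestrict T)
  -- complex-linear symmetrisation, corestricted to the range
  let SymC : NormalJetSpace B j →ₗ[ℂ] NormalJetSpace B j :=
    { toFun := symmetrize, map_add' := symmetrize_add, map_smul' := symmetrize_smul }
  have hSym : ∀ m, SymC m ∈ LinearMap.range T := fun m =>
    mem_range_symContractOpC_of_symmetric j hη (symmetrize_comp_perm m)
  let Rc : NormalJetSpace B j →ₗ[ℂ] NormalJetSpace B (j + 2) := g ∘ₗ LinearMap.codRestrict (LinearMap.range T) SymC hSym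
  refine ⟨(LinearMap.toContinuousLinearMap Rc).restrictScalars ℝ, fun m => ?_⟩
  have h1 := LinearMap.congr_fun hg (LinearMap.codRestrict (LinearMap.range T) SymC hSym m)
  have h2 := congrArg Subtype.val h1
  simpa [Rc, SymC, T] using h2

end Surj

/-! ### 3. Smooth dependence and smooth preimages -/

section Param

variable [FiniteDimensional ℝ B] {K : Type*} [Fintype K]

omit [NormedSpace ℝ Z] [FiniteDimensional ℝ B] [Fintype K] in
/-- The set where a continuous family of operators is invertible is open. [folklore] -/
theorem isOpen_setOf_isInvertible {E : Type*} [NormedAddCommGroup E] [NormedSpace ℝ E] [CompleteSpace E]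
    {M : Z → E →L[ℝ] E} (hM : Continuous M) : IsOpen {z : Z | (M z).IsInvertible} := by
  have h1 : {z : Z | (M z).IsInvertible} = M ⁻¹' range ((↑) : (E ≃L[ℝ] E) → E →L[ℝ] E) := by
    ext z; simp only [mem_setOf_eq, mem_preimage, mem_range, ContinuousLinearMap.IsInvertible]
  rw [h1]
  exact ContinuousLinearEquiv.isOpen.preimage hM

omit [FiniteDimensional ℝ B] [Fintype K] in
/-- Evaluation of the first slot is jointly smooth in the vector and the form. [folklore] -/
theorem contDiff_evalFirstL_apply (j : ℕ) {x : Z → B} {u : Z → NormalJetSpace B (j + 1)} (hx : ContDiff ℝ ∞ x)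
    (hu : ContDiff ℝ ∞ u) : ContDiff ℝ ∞ fun z => evalFirstL (B := B) j (x z) (u z) :=
  (evalFirstL (B := B) j).isBoundedBilinearMap.contDiff.comp (hx.prodMk hu)

omit [FiniteDimensional ℝ B] in
/-- The contraction of smooth data applied to a smooth jet field is smooth. [folklore] -/
theorem contDiff_contractOp_apply (j : ℕ) {a : K → Z → ℂ} {n n' : K → Z → B} (ha : ∀ k, ContDiff ℝ ∞ (a k))
    (hn : ∀ k, ContDiff ℝ ∞ (n k)) (hn' : ∀ k, ContDiff ℝ ∞ (n' k)) {u : Z → NormalJetSpace B (j + 2)} (hu : ContDiff ℝ ∞ u) :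
    ContDiff ℝ ∞ fun z => contractOp j (fun k => a k z) (fun k => n k z) (fun k => n' k z) (u z) := by
  have h1 : (fun z => contractOp j (fun k => a k z) (fun k => n k z) (fun k => n' k z) (u z)) = fun z =>
      ∑ k, a k z • evalFirstL (B := B) j (n k z) (evalFirstL (B := B) (j + 1) (n' k z) (u z)) := by
    funext z
    simp only [contractOp, FunLike.coe_sum, Finset.sum_apply, FunLike.coe_smul, Pi.smul_apply,
      ContinuousLinearMap.coe_comp, Function.comp_apply]
  rw [h1]
  exact ContDiff.sum fun k _ => (ha k).smul (contDiff_evalFirstL_apply j (hn k) (contDiff_evalFirstL_apply (j + 1) (hn' k) hu))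

/-- **The symmetrised contraction of smooth data depends smoothly on the parameter** (as an
operator-valued map; `S_{j+2}` is finite-dimensional). [folklore] -/
theorem contDiff_symContractOp (j : ℕ) {a : K → Z → ℂ} {n n' : K → Z → B} (ha : ∀ k, ContDiff ℝ ∞ (a k))
    (hn : ∀ k, ContDiff ℝ ∞ (n k)) (hn' : ∀ k, ContDiff ℝ ∞ (n' k)) :
    ContDiff ℝ ∞ fun z => symContractOp j (fun k => a k z) (fun k => n k z) (fun k => n' k z) := by
  refine contDiff_clm_apply_iff.2 fun w => ?_
  simp only [symContractOp_apply]
  exact (symmetrizeCLM (B := B) j).contDiff.comp (contDiff_contractOp_apply j ha hn hn' contDiff_const)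

/-- `symmetrize` of a difference. [folklore] -/
theorem symmetrize_sub {j : ℕ} (m m' : NormalJetSpace B j) : symmetrize (m - m') = symmetrize m - symmetrize m' :=
  map_sub (symmetrizeCLM (B := B) j) m m'

/-- **Smooth compactly supported preimages under the symmetrised contraction**: if the symbol at `z₀`
is non-zero on some real covector, then near `z₀` every smooth compactly supported *symmetric*
`S_j`-valued `m` is `T_z (w z)` with `w` smooth and compactly supported inside `tsupport m`.
[cite: HormanderALPDO1, Thm. 2.3.5, §3.1] -/
theorem exists_smooth_symContract_preimage (j : ℕ) {a : K → Z → ℂ} {n n' : K → Z → B} (ha : ∀ k, ContDiff ℝ ∞ (a k))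
    (hn : ∀ k, ContDiff ℝ ∞ (n k)) (hn' : ∀ k, ContDiff ℝ ∞ (n' k)) {z₀ : Z} {η : B →L[ℝ] ℝ}
    (hη : qForm (fun k => a k z₀) (fun k => n k z₀) (fun k => n' k z₀) η ≠ 0) :
    ∃ O ∈ 𝓝 z₀, ∀ m : Z → NormalJetSpace B j, ContDiff ℝ ∞ m → HasCompactSupport m → tsupport m ⊆ O →
      (∀ (z : Z) (v : Fin j → B) (σ : Equiv.Perm (Fin j)), m z (v ∘ σ) = m z v) →
      ∃ w : Z → NormalJetSpace B (j + 2), ContDiff ℝ ∞ w ∧ HasCompactSupport w ∧ tsupport w ⊆ tsupport m ∧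
        ∀ z, symContractOp j (fun k => a k z) (fun k => n k z) (fun k => n' k z) (w z) = m z := by
  set T : Z → NormalJetSpace B (j + 2) →L[ℝ] NormalJetSpace B j :=
    fun z => symContractOp j (fun k => a k z) (fun k => n k z) (fun k => n' k z) with hTdef
  have hT : ContDiff ℝ ∞ T := contDiff_symContractOp j ha hn hn'
  obtain ⟨R, hR⟩ := exists_rightInverse_symContractOp j hη
  -- the auxiliary family `Φ z = T z ∘ R + (1 - Sym)`, the identity at `z₀`
  set Φ : Z → NormalJetSpace B j →L[ℝ] NormalJetSpace B j :=
    fun z => (T z).comp R + (ContinuousLinearMap.id ℝ (NormalJetSpace B j) - symmetrizeCLM j) with hΦdef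
  have hΦ : ContDiff ℝ ∞ Φ := (hT.clm_comp contDiff_const).add contDiff_const
  have hΦ0 : Φ z₀ = ContinuousLinearMap.id ℝ (NormalJetSpace B j) := by
    refine ContinuousLinearMap.ext fun m => ?_
    simp only [hΦdef, add_apply, ContinuousLinearMap.coe_comp, Function.comp_apply,
      sub_apply, ContinuousLinearMap.id_apply, symmetrizeCLM_apply]
    rw [show T z₀ (R m) = symmetrize m from hR m]
    abel
  have hinv0 : (Φ z₀).IsInvertible := by rw [hΦ0]; exact ⟨ContinuousLinearEquiv.refl ℝ _, rfl⟩
  have hO : IsOpen {z : Z | (Φ z).IsInvertible} := isOpen_setOf_isInvertible hΦ.continuous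
  refine ⟨{z : Z | (Φ z).IsInvertible}, hO.mem_nhds hinv0, fun m hm hmc hmO hmsym => ?_⟩
  obtain ⟨m', hm', hm'c, hm'supp, hm'eq⟩ := exists_smooth_preimage hΦ hm hmc fun z hz => hmO hz
  refine ⟨fun z => R (m' z), R.contDiff.comp hm', ?_, ?_, fun z => ?_⟩
  · refine IsCompact.of_isClosed_subset hm'c (isClosed_tsupport _) (closure_mono fun z hz => ?_)
    rw [Function.mem_support] at hz ⊢
    intro h0; exact hz (by simp [h0])
  · refine (closure_mono fun z hz => ?_).trans hm'supp
    rw [Function.mem_support] at hz ⊢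
    intro h0; exact hz (by simp [h0])
  · -- `m z = Φ z (m' z) = T z (R m') + m' - Sym m'`; symmetrise
    have h1 : T z (R (m' z)) + (m' z - symmetrize (m' z)) = m z := by
      have := hm'eq z
      simpa [hΦdef] using this
    have h2 := congrArg symmetrize h1
    rw [symmetrize_add, symmetrize_sub, symmetrize_symmetrize, sub_self, add_zero, hTdef, symmetrize_symContractOp,
      symmetrize_eq_self_of_forall_comp_perm (hmsym z)] at h2
    exact h2

end Param


end Literature.Analysis.Distribution
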